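import Literature.AlgebraicGeometry.Resolution.QuadraticTransformsStructure
import Mathlib.RingTheory.Ideal.MinimalPrime.Noetherian

/-!
# Prime divisors of an element along a quadratic sequence: the valuation rings `R_𝔮`

Helper file for the stub `stub_curveMonomialization` of the line `pfaff-line-log-final-forms`
(crux `Valuative.LuAlphaPTorsor`, item `stmt-ResolutionOfSingularities-0641`): embedded
resolution of a plane curve germ `b = 0` along a valuation, by the sequence of quadratic
transforms of a two-dimensional regular local ring `R ⊆ K` (Zariski; Abhyankar 1956).

The bookkeeping device. For a two-dimensional regular local ring `R` of `K` (`Frac R = K`) and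
`0 ≠ b ∈ R`, the *prime divisors of `b` on `Spec R`* are recorded instance-free as the valuation
rings `W` of `K` with `R ⊆ W`, `w(b) > 0` (`W.valuation b < 1`) and `W` NOT dominating `R`.
PROVED here: such a `W` is the local ring `R_𝔮` (`LocalSubring.ofPrime`) of `R` at its centre
`𝔮 = 𝔪_W ∩ R`, a height-one prime containing `b` (a minimal prime of `bR`), and has Krull
dimension `≤ 1` (`exists_centre`); conversely every prime `𝔮 ≠ 𝔪_R, 0` of `R` is the centre of
such a `W = R_𝔮` (`exists_valuationSubring_of_prime`); hence there are finitely many of them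
(`finite_divisors`), and a valuation ring `O ⊆ W₀` of `K` lies in no other divisor `W ≠ W₀` of
`b` unless `𝔪_{W₀} ⊆ 𝔪_W` (`valuation_lt_one_of_followed`). All [folklore]
(Zariski–Samuel II, Ch. VI; Abhyankar 1956, §2).
-/

set_option linter.dupNamespace false

namespace Summit.ResolutionOfSingularities.ResolutionOfSingularities.Theorems.PfaffLine.CurveMono

open IsLocalRing Literature.AlgebraicGeometry.Resolution

variable {K : Type} [Field K]

/-! ## Valuation rings: elements of positive value -/

/-- `w(x) > 0` iff `x = 0` or `x⁻¹ ∉ W`. [folklore] -/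
theorem valuation_lt_one_iff_or (W : ValuationSubring K) (x : K) :
    W.valuation x < 1 ↔ x = 0 ∨ x⁻¹ ∉ W := by
  rw [← ValuationSubring.mem_nonunits_iff, ValuationSubring.mem_nonunits_iff_or]

/-- An element of `W` of value not `> 0` (i.e. not `< 1`) has value `1`. [folklore] -/
theorem valuation_eq_one_of_not_lt {W : ValuationSubring K} {x : K} (hx : x ∈ W)
    (h : ¬ W.valuation x < 1) : W.valuation x = 1 :=
  le_antisymm ((W.valuation_le_one_iff x).mpr hx) (not_lt.mp h)

/-- An element of `W` of value not `< 1` is a unit of `W`: its inverse lies in `W`. [folklore] -/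
theorem inv_mem_of_not_lt {W : ValuationSubring K} {x : K} (hx : x ∈ W)
    (h : ¬ W.valuation x < 1) : x⁻¹ ∈ W := by
  rw [← W.valuation_le_one_iff, map_inv₀, valuation_eq_one_of_not_lt hx h, inv_one]

/-- If `W ≤ W'` then `𝔪_{W'} ⊆ 𝔪_W`: positive `W'`-value implies positive `W`-value. [folklore] -/
theorem valuation_lt_one_of_le {W W' : ValuationSubring K} (h : W ≤ W') {x : K}
    (hx : W'.valuation x < 1) : W.valuation x < 1 :=
  (ValuationSubring.mem_nonunits_iff _).mp
    ((ValuationSubring.nonunits_le_nonunits.mpr h) ((ValuationSubring.mem_nonunits_iff _).mpr hx))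

/-- A quotient `u / v` with `w(u) > 0` and `w(v) = 0` has `w(u/v) > 0`. [folklore] -/
theorem valuation_div_lt_one {W : ValuationSubring K} {u v : K} (hu : W.valuation u < 1)
    (hv : W.valuation v = 1) : W.valuation (u / v) < 1 := by
  rw [map_div₀, hv, div_one]
  exact hu

/-! ## Domination by a valuation ring -/

/-- If `W` dominates the local subring `R` then the non-units of `R` have positive value.
[folklore] -/
theorem valuation_lt_one_of_dominates {R : Subring K} [IsLocalRing R] {W : ValuationSubring K}
    (h : SubringDominates R W.toSubring) {y : R} (hy : y ∈ maximalIdeal R) :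
    W.valuation (y : K) < 1 := by
  rcases (mem_maximalIdeal_iff_inv_not_mem y).mp hy with h0 | hinv
  · rw [h0, map_zero]; exact zero_lt_one
  · exact (valuation_lt_one_iff_or W _).mpr (Or.inr fun hyW => hinv (h.2 _ y.2 hyW))

/-- Conversely, `W ⊇ R` dominates the local subring `R` as soon as the non-units of `R` have
positive value. [folklore] -/
theorem dominates_of_maximalIdeal {R : Subring K} [IsLocalRing R] {W : ValuationSubring K}
    (hRW : R ≤ W.toSubring) (h : ∀ y ∈ maximalIdeal R, W.valuation (y : K) < 1) :
    SubringDominates R W.toSubring := by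
  rw [subringDominates_valuationSubring_iff hRW]
  refine fun a => ⟨h a, fun ha => ?_⟩
  rw [mem_maximalIdeal_iff_inv_not_mem]
  rcases (valuation_lt_one_iff_or W a).mp ha with h0 | hinv
  · exact Or.inl h0
  · exact Or.inr fun haR => hinv (hRW haR)

/-- If `W ⊇ R` does not dominate the local ring `R` with `𝔪_R = (u, v)` and `w(u) > 0`, then
`w(v) = 0`. [folklore] -/
theorem not_valuation_lt_one_of_span_pair {R : Subring K} [IsLocalRing R]
    {W : ValuationSubring K} (hRW : R ≤ W.toSubring) (hnd : ¬ SubringDominates R W.toSubring)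
    {u v : R} (huv : maximalIdeal R = Ideal.span {u, v}) (hu : W.valuation (u : K) < 1) :
    ¬ W.valuation (v : K) < 1 := by
  intro hv
  refine hnd (dominates_of_maximalIdeal hRW fun y hy => ?_)
  rw [huv, Ideal.mem_span_pair] at hy
  obtain ⟨a, c, rfl⟩ := hy
  have ha : W.valuation (a : K) ≤ 1 := (W.valuation_le_one_iff _).mpr (hRW a.2)
  have hc : W.valuation (c : K) ≤ 1 := (W.valuation_le_one_iff _).mpr (hRW c.2)
  rw [Subring.coe_add, Subring.coe_mul, Subring.coe_mul]
  refine (Valuation.map_add _ _ _).trans_lt (max_lt ?_ ?_)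
  · rw [map_mul]
    calc W.valuation (a : K) * W.valuation (u : K) ≤ 1 * W.valuation (u : K) :=
          mul_le_mul' ha le_rfl
      _ < 1 := by rw [one_mul]; exact hu
  · rw [map_mul]
    calc W.valuation (c : K) * W.valuation (v : K) ≤ 1 * W.valuation (v : K) :=
          mul_le_mul' hc le_rfl
      _ < 1 := by rw [one_mul]; exact hv

/-- A member of a chain of dominations: if `S` dominates `R` and `W` dominates `S` then `W`
dominates `R`; contrapositive form used along the quadratic sequence. [folklore] -/
theorem not_dominates_of_dominates {R S : Subring K} {W : ValuationSubring K}
    (hRS : SubringDominates R S) (hnd : ¬ SubringDominates R W.toSubring) :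
    ¬ SubringDominates S W.toSubring :=
  fun h => hnd (hRS.trans h)

/-! ## The valuation ring `R_𝔮` of a height-one prime -/

/-- **The local ring of a two-dimensional regular local ring `R` of `K` at a prime
`𝔮 ≠ 𝔪_R` is a valuation ring of `K`** (`𝔮 = (p)` is principal; `K` itself if `𝔮 = 0`),
containing `R`, not dominating `R`, of Krull dimension `≤ 1`, whose elements of positive value in
`R` are exactly those of `𝔮`. [folklore] -/
theorem exists_valuationSubring_of_prime {R : Subring K} [IsRegularLocalRing R]
    (hdim : ringKrullDim R = 2) (hof : IsLocalRingOf R) (𝔮 : Ideal R) [𝔮.IsPrime]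
    (h𝔮m : 𝔮 ≠ maximalIdeal R) :
    ∃ W : ValuationSubring K, W.toSubring = (LocalSubring.ofPrime R 𝔮).toSubring ∧
      R ≤ W.toSubring ∧ (∀ y : R, W.valuation (y : K) < 1 ↔ y ∈ 𝔮) ∧
      ¬ SubringDominates R W.toSubring ∧ Ring.KrullDimLE 1 W := by
  obtain ⟨p, hp⟩ := exists_eq_span_singleton_of_ne_maximalIdeal hdim 𝔮 h𝔮m
  let W : ValuationSubring K := ValuationSubring.ofSubring (LocalSubring.ofPrime R 𝔮).toSubring
    (mem_or_inv_mem_ofPrime_of_span_singleton hp hof.2)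
  have hW : W.toSubring = (LocalSubring.ofPrime R 𝔮).toSubring := rfl
  have hmemW : ∀ z : K, z ∈ W ↔ z ∈ (LocalSubring.ofPrime R 𝔮).toSubring := fun z => Iff.rfl
  have hRW : R ≤ W.toSubring := LocalSubring.le_ofPrime R 𝔮
  -- the elements of `R` of positive value are those of `𝔮`
  have hval : ∀ y : R, W.valuation (y : K) < 1 ↔ y ∈ 𝔮 := by
    intro y
    rw [valuation_lt_one_iff_or]
    constructor
    · rintro (h0 | hinv)
      · rw [show y = 0 from Subtype.ext h0]; exact 𝔮.zero_mem
      · by_contra hy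
        exact hinv ((hmemW _).mpr (inv_mem_ofPrime hy))
    · intro hy
      by_cases h0 : (y : K) = 0
      · exact Or.inl h0
      · refine Or.inr fun hinv => ?_
        obtain ⟨a, s, hs, has⟩ := mem_ofPrime_iff.mp ((hmemW _).mp hinv)
        have hs0 : ((s : R) : K) ≠ 0 := coe_ne_zero_of_not_mem (K := K) hs
        -- `s = a y ∈ 𝔮`, a contradiction
        apply hs
        have e : s = a * y := Subtype.ext (by
          rw [Subring.coe_mul]
          field_simp at has
          linear_combination has)
        rw [e]
        exact 𝔮.mul_mem_left _ hy
  refine ⟨W, hW, hRW, hval, ?_, ?_⟩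
  · -- `W` does not dominate `R`: an element of `𝔪_R ∖ 𝔮` is a unit of `W`
    intro hdom
    have hlt : 𝔮 < maximalIdeal R := lt_of_le_of_ne (IsLocalRing.le_maximalIdeal
      (Ideal.IsPrime.ne_top ‹_›)) h𝔮m
    obtain ⟨y, hym, hy𝔮⟩ := SetLike.exists_of_lt hlt
    exact (hval y).not.mpr hy𝔮 (valuation_lt_one_of_dominates hdom hym)
  · -- dimension `≤ 1`: a Noetherian local valuation ring of `K`
    haveI : IsNoetherianRing (LocalSubring.ofPrime R 𝔮).toSubring := isNoetherianRing_ofPrime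
    have h1 : ringKrullDim (LocalSubring.ofPrime R 𝔮).toSubring ≤ 1 :=
      ringKrullDim_le_one_of_forall_mem_or_inv_mem
        (mem_or_inv_mem_ofPrime_of_span_singleton hp hof.2)
    exact Ring.krullDimLE_iff.mpr h1

/-- **The centre of a divisor.** Let `R` be a two-dimensional regular local ring of `K` and `W`
a valuation ring of `K` containing `R`, not dominating it, with `w(b) > 0` for some
`0 ≠ b ∈ R`. Then the centre `𝔮 = 𝔪_W ∩ R` is a prime ideal `≠ 𝔪_R` containing `b`, minimal
over `bR`, `W = R_𝔮`, and `dim W ≤ 1`. [folklore] -/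
theorem exists_centre {R : Subring K} [IsRegularLocalRing R] (hdim : ringKrullDim R = 2)
    (hof : IsLocalRingOf R) {W : ValuationSubring K} (hRW : R ≤ W.toSubring)
    (hnd : ¬ SubringDominates R W.toSubring) {b : K} (hbR : b ∈ R) (hb0 : b ≠ 0)
    (hbW : W.valuation b < 1) :
    ∃ (𝔮 : Ideal R) (_ : 𝔮.IsPrime), (∀ y : R, y ∈ 𝔮 ↔ W.valuation (y : K) < 1) ∧
      𝔮 ≠ maximalIdeal R ∧ (⟨b, hbR⟩ : R) ∈ 𝔮 ∧
      𝔮 ∈ (Ideal.span {(⟨b, hbR⟩ : R)}).minimalPrimes ∧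
      W.toSubring = (LocalSubring.ofPrime R 𝔮).toSubring ∧ Ring.KrullDimLE 1 W := by
  let 𝔮 : Ideal R := (maximalIdeal W).comap (Subring.inclusion hRW)
  haveI h𝔮 : 𝔮.IsPrime := Ideal.comap_isPrime _ _
  have hmem : ∀ y : R, y ∈ 𝔮 ↔ W.valuation (y : K) < 1 := fun y => by
    rw [Ideal.mem_comap, ValuationSubring.valuation_lt_one_iff]
    rfl
  -- `𝔮 ≠ 𝔪_R`: an element of `R` with inverse in `W ∖ R` is a non-unit outside `𝔮`
  have h𝔮m : 𝔮 ≠ maximalIdeal R := by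
    intro h𝔮m
    apply hnd
    refine ⟨hRW, fun x hx hxW => ?_⟩
    by_contra hxR
    have hx0 : x ≠ 0 := by rintro rfl; exact hxR (by rw [inv_zero]; exact R.zero_mem)
    have hxm : (⟨x, hx⟩ : R) ∈ maximalIdeal R :=
      (mem_maximalIdeal_iff_inv_not_mem _).mpr (Or.inr hxR)
    rw [← h𝔮m, hmem, valuation_lt_one_iff_or] at hxm
    exact hxm.elim (fun h => hx0 h) (fun h => h hxW)
  have hb𝔮 : (⟨b, hbR⟩ : R) ∈ 𝔮 := (hmem _).mpr hbW
  have h𝔮0 : 𝔮 ≠ ⊥ := fun h => hb0 (by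
    have : (⟨b, hbR⟩ : R) = 0 := by rw [h] at hb𝔮; exact hb𝔮
    exact congrArg Subtype.val this)
  -- `W = R_𝔮` by maximality of the one-dimensional valuation ring `R_𝔮 ⊆ W ≠ K`
  obtain ⟨W₁, hW₁, -, -, -, hdim₁⟩ := exists_valuationSubring_of_prime hdim hof 𝔮 h𝔮m
  haveI := hdim₁
  have hle : W₁ ≤ W := by
    intro z hz
    have hz' : z ∈ (LocalSubring.ofPrime R 𝔮).toSubring := by rw [← hW₁]; exact hz
    refine ofPrime_le (T := W.toSubring) hRW (fun s hs => ?_) hz'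
    exact inv_mem_of_not_lt (hRW s.2) ((hmem s).not.mp hs)
  have htop : W ≠ ⊤ := by
    rintro rfl
    rcases (valuation_lt_one_iff_or ⊤ b).mp hbW with h | h
    · exact hb0 h
    · exact h (ValuationSubring.mem_top _)
  have heq : W₁ = W := ValuationSubring.eq_of_le_of_ne_top W₁ hle htop
  subst heq
  refine ⟨𝔮, h𝔮, hmem, h𝔮m, hb𝔮, ?_, hW₁, hdim₁⟩
  -- minimality over `bR`: a smaller prime containing `b` is principal, generated by a multiple
  -- of the generator of `𝔮`
  refine ⟨⟨h𝔮, (Ideal.span_singleton_le_iff_mem _).mpr hb𝔮⟩, ?_⟩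
  rintro J ⟨hJ, hbJ⟩ hJ𝔮
  haveI := hJ
  rw [Ideal.span_singleton_le_iff_mem] at hbJ
  have hJm : J ≠ maximalIdeal R := fun h => h𝔮m (le_antisymm (IsLocalRing.le_maximalIdeal
    (Ideal.IsPrime.ne_top ‹_›)) (h ▸ hJ𝔮))
  obtain ⟨p, hp⟩ := exists_eq_span_singleton_of_ne_maximalIdeal hdim 𝔮 h𝔮m
  obtain ⟨p', hp'⟩ := exists_eq_span_singleton_of_ne_maximalIdeal hdim J hJm
  rw [hp'] at hbJ hJ𝔮 hJ ⊢
  rw [hp] at hJ𝔮 ⊢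
  have hp'0 : p' ≠ 0 := by
    rintro rfl
    rw [Ideal.mem_span_singleton] at hbJ
    exact hb0 (by
      have : (⟨b, hbR⟩ : R) = 0 := zero_dvd_iff.mp hbJ
      exact congrArg Subtype.val this)
  have hp'prime : Prime p' := (Ideal.span_singleton_prime hp'0).mp hJ
  have hp'mem : p' ∈ Ideal.span {p} := hJ𝔮 (Ideal.mem_span_singleton_self p')
  obtain ⟨c, hc⟩ := Ideal.mem_span_singleton'.mp hp'mem
  -- `p' = c p`: the prime `p'` divides `c` or `p`
  rcases hp'prime.dvd_or_dvd (show p' ∣ c * p from ⟨1, by rw [mul_one, hc]⟩) with hdc | hdp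
  · exfalso
    obtain ⟨d, rfl⟩ := hdc
    -- `p' = p' d p` forces `p` to be a unit
    have h1 : p' * 1 = p' * (d * p) := by rw [mul_one, ← mul_assoc]; exact hc.symm
    have hpu : IsUnit p := IsUnit.of_mul_eq_one_right d (mul_left_cancel₀ hp'0 h1).symm
    refine (Ideal.IsPrime.ne_top h𝔮) ?_
    rw [hp]
    exact Ideal.span_singleton_eq_top.mpr hpu
  · exact Ideal.span_singleton_le_span_singleton.mpr hdp

/-- **Finiteness of the prime divisors of `b`.** For a two-dimensional regular local ring `R` of
`K` and `0 ≠ b ∈ R`, the valuation rings `W ⊇ R` of `K` with `w(b) > 0` not dominating `R`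
are finitely many (they are the `R_𝔮`, `𝔮` a minimal prime of `bR`). [folklore] -/
theorem finite_divisors {R : Subring K} [IsRegularLocalRing R] (hdim : ringKrullDim R = 2)
    (hof : IsLocalRingOf R) {b : K} (hbR : b ∈ R) (hb0 : b ≠ 0) :
    {W : ValuationSubring K | R ≤ W.toSubring ∧ W.valuation b < 1 ∧
      ¬ SubringDominates R W.toSubring}.Finite := by
  have hfin := Ideal.finite_minimalPrimes_of_isNoetherianRing R (Ideal.span {(⟨b, hbR⟩ : R)})
  refine (hfin.biUnion (t := fun 𝔮 => {W : ValuationSubring K | (R ≤ W.toSubring ∧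
      W.valuation b < 1 ∧ ¬ SubringDominates R W.toSubring) ∧
      ∀ y : R, y ∈ 𝔮 ↔ W.valuation (y : K) < 1}) fun 𝔮 _ => ?_).subset ?_
  · -- each fibre is a subsingleton: `W = R_𝔮`
    refine Set.Subsingleton.finite fun W hW W' hW' => ?_
    obtain ⟨⟨hRW, hbW, hnd⟩, hW𝔮⟩ := hW
    obtain ⟨⟨hRW', hbW', hnd'⟩, hW'𝔮⟩ := hW'
    obtain ⟨𝔮₁, h₁, hmem₁, -, -, -, hW₁, -⟩ := exists_centre hdim hof hRW hnd hbR hb0 hbW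
    obtain ⟨𝔮₂, h₂, hmem₂, -, -, -, hW₂, -⟩ := exists_centre hdim hof hRW' hnd' hbR hb0 hbW'
    have e₁ : 𝔮₁ = 𝔮 := by ext y; rw [hmem₁, hW𝔮]
    have e₂ : 𝔮₂ = 𝔮 := by ext y; rw [hmem₂, hW'𝔮]
    subst e₁; subst e₂
    exact ValuationSubring.toSubring_injective (hW₁.trans hW₂.symm)
  · rintro W ⟨hRW, hbW, hnd⟩
    obtain ⟨𝔮, h𝔮, hmem, -, -, hmin, -, -⟩ := exists_centre hdim hof hRW hnd hbR hb0 hbW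
    exact Set.mem_biUnion hmin ⟨⟨hRW, hbW, hnd⟩, hmem⟩

/-- **A divisor containing a valuation ring `O` is essentially unique.** If `W₀ ⊇ R` is a
divisor of `b` (not dominating `R`, `w₀(b) > 0`) containing the valuation ring `O`, then every
valuation ring `W ⊇ O` with `w(b) > 0` satisfies `𝔪_{W₀} ⊆ 𝔪_W` (indeed `W = W₀` or
`W ⊆ W₀`, the overrings of `O` being totally ordered and `W₀` one-dimensional). [folklore] -/
theorem valuation_lt_one_of_followed {R : Subring K} [IsRegularLocalRing R]
    (hdim : ringKrullDim R = 2) (hof : IsLocalRingOf R) {O W₀ W : ValuationSubring K}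
    (hRW₀ : R ≤ W₀.toSubring) (hnd₀ : ¬ SubringDominates R W₀.toSubring) {b : K} (hbR : b ∈ R)
    (hb0 : b ≠ 0) (hbW₀ : W₀.valuation b < 1) (hOW₀ : O ≤ W₀) (hOW : O ≤ W)
    (hbW : W.valuation b < 1) {x : K} (hx : W₀.valuation x < 1) : W.valuation x < 1 := by
  obtain ⟨𝔮, h𝔮, -, -, -, -, -, hdim₀⟩ := exists_centre hdim hof hRW₀ hnd₀ hbR hb0 hbW₀
  haveI := hdim₀
  have htop : W ≠ ⊤ := by
    rintro rfl
    rcases (valuation_lt_one_iff_or ⊤ b).mp hbW with h | h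
    · exact hb0 h
    · exact h (ValuationSubring.mem_top _)
  rcases le_total (⟨W, hOW⟩ : {S // O ≤ S}) ⟨W₀, hOW₀⟩ with hle | hle
  · exact valuation_lt_one_of_le (show W ≤ W₀ from hle) hx
  · have heq : W₀ = W := ValuationSubring.eq_of_le_of_ne_top W₀ (show W₀ ≤ W from hle) htop
    rw [← heq]
    exact hx

end Summit.ResolutionOfSingularities.ResolutionOfSingularities.Theorems.PfaffLine.CurveMono

namespace Summit.ResolutionOfSingularities.ResolutionOfSingularities.Theorems.PfaffLine

/-- **Registered sub-goal `curveMono_finite_divisors`** (universe `0`, for `--supports`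
registration): the prime divisors of `0 ≠ b ∈ R` — valuation rings `W ⊇ R` with `w(b) > 0` not
dominating the two-dimensional regular local ring `R` of `K` — are finitely many. [folklore] -/
theorem curveMono_finite_divisors : ∀ {K : Type} [Field K] {R : Subring K} [IsRegularLocalRing R], ringKrullDim R = 2 → Literature.AlgebraicGeometry.Resolution.IsLocalRingOf R → ∀ {b : K}, b ∈ R → b ≠ 0 → {W : ValuationSubring K | R ≤ W.toSubring ∧ W.valuation b < 1 ∧ ¬ Literature.AlgebraicGeometry.Resolution.SubringDominates R W.toSubring}.Finite := by
  intro K _ R _ hdim hof b hbR hb0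
  exact CurveMono.finite_divisors hdim hof hbR hb0

end Summit.ResolutionOfSingularities.ResolutionOfSingularities.Theorems.PfaffLine
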